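import Literature.MathematicalPhysics.QuantumFieldTheory.Balaban1983to89.Beta.BetaContinuityVolume
import Literature.Analysis.Complex.SeveralVariables

/-!
# Bałaban's β-functions: the finite-volume continuity clause (C-fin) from the (2.13) recursion — Cauchy transfer of
# POINTWISE parameter-continuity from the VALUES of a bounded analytic family to its (1.20) derivatives, and the tower
# of exponentiated (2.13) integrals (dominated convergence with a MOVING cutoff)

T. Bałaban, *Renormalization group approach to lattice gauge field theories. I. Generation of effective actions in a
small field approximation and a coupling constant renormalization in four dimensions*, Commun. Math. Phys. **109**,
249–301 (1987) [Balaban1987RG1] (cell paper B12 = [I]; PDF page = journal page − 248; PDF held: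
`paper:balaban1987-cmp109-rg-i-small-field`).

CITATION HEADER (lean-in-tree rule 2026-08-18).  KERNEL-CHECKED BOOKKEEPING ([folklore] complex and real analysis)
for the β sub-cell of the Bałaban YM₄ reconstruction (audit cell `pub-balaban`; unit `b2b-balaban-beta-an4` gen 3 = row
BETA-an4 "k-uniform remainder", journal claim AN4-HISTCONT; cell records `HOME/BETA-SPEC.md` §6 row (C) "owner an4,
OPEN-ROUTINE", `HOME/GAPS.md` G-an4-1 (iv) / C-an4-2, `HOME/BETA/REMAINDER-BETA.md` §5).  It sits UNDER two LANDED
modules and touches neither: `…Beta.BetaContinuityVolume` (this row, gen 2: (C) ⇐ (C-fin) + (VR-u),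
`betaContH_of_chain_volumeRate`, `thm2Printed_of_remainderChain_vol`, `endpointExistence_of_remainderChain_vol`) and
`…B12Decay510` §8 (the mixed second derivative `mixedDeriv` of the (4.35)/(1.20) dictionaries), and uses the project's
several-complex-variables file `Literature.Analysis.Complex.SCV` (`hasDerivAt_slice_zero`, `norm_fderiv_apply_le`)
and Mathlib's Cauchy formula / dominated convergence BY NAME; nothing is re-proved.

THE PRINTED TEXT THIS MODULE IS ABOUT (verbatim, from the 300-dpi renders `1987-cmp109-rg-I-small-field-pNNN-x2.png`,
NNN ∈ {015, 016, 018, 019, 020}, under `HOME/b2b-balaban-ref1/pages/1987-cmp109-rg-I-small-field/`, re-read by this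
seat):
* p. 263 [PDF 15]: *"We assume that the function E^{(j)}(X, g_{j−1}, U, J) is defined and analytic on the space
  U^c_j(X, α₀, α₁), with some positive, absolute constants α₀, α₁ (i.e., constants independent of X and j). It depends
  on the configurations restricted to X, i.e. on (U, J)|_X. It is a C^∞-function of g_{j−1} ∈ [0, γ], (or analytic),
  with a positive, absolute γ. There exists a constant E₀ such that |E^{(j)}(X, g_{j−1}, U, J)| ≦ E₀ exp(−κd_j(X)) (1.18)
  for M ≧ M(κ), γ sufficiently small, and for all configurations (U, J) ∈ U^c_j(X, α₀, α₁)."*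
* p. 264 [PDF 16]: *"They are determined by the functions E^{(j+1)}(g_j, U_{j+1}) in (1.6). Let us denote
  E^{(j+1)}(g_j, B) = E^{(j+1)}(g_j, U_{j+1}(exp iB)). We define Π^{ab}_{j+1,μν}(g_j, x, x′) =
  (δ²/δB^a_μ(x)δB^b_ν(x′) E^{(j+1)})(g_j, 0). (1.20) This is the vacuum polarization tensor of the theory defined by the
  j-th fluctuation field integral."* … *"This implies Π^{ab}_{j+1,μν}(g_j, x, x′) = δ^{ab}Π_{j+1,μν}(g_j, x − x′), …
  (1.21) … Now we take a limit of these functions as T^{(j+1)} ↗ Z^d."* … after (1.22): *"It is a smooth function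
  defined on the interval [0, γ], (or analytic), uniformly bounded on this interval together with all derivatives."*
* p. 266 [PDF 18], (2.9): *"Finally we can define the characteristic function χ_k  χ_k = Π_{b∈T^{(k)}∖{b₀(c): c∈T^{(k+1)}}}
  χ({|B′(b)| < ε₁}). (2.9) Another possibility is to take g_k/γ_kε₁ instead of ε₁, where γ_k = C log(L^kε)^{−1} with C
  sufficiently large. It has the advantage that the functions E^{(j)}, β_j are analytic functions of the effective
  coupling constants, but it has some disadvantages in perturbative calculations also."*
* p. 267 [PDF 19]: *"We are looking for an analytic, g-valued function D̃(B′), defined at bonds of T^{(k+1)}, and such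
  that the transformation B′ = B − hD̃(B) linearizes the function Q̃(B′)."* … *"The above change of variables yields the
  integral with the δ-function δ(Q̃B). Next we make the scaling transformation B = g_kB′."*
* p. 268 [PDF 20]: *"Denoting the remaining variables by B we have B′ = CB, C is the operator determined by the
  configuration V^{(k)}, and the measure becomes a Gaussian measure in variables B, with the covariance C^{(k)} =
  C^{(k)}(U_{k+1}) = (C*Δ^{(k)}C)^{−1}."*; the last term of (2.12): *"+ {E_k(U_k(exp i[g_kCB − hD̃(g_kCB)]V^{(k)})) −
  E_k(U_k(V^{(k)}))}"*; and: *"The expression under the exponential is clearly a sum of two terms, one is connected with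
  the expansion of the action −(1/g_k²)A(U_k(V)) and the measure in (2.1), and we denote it by P^{(k)}(g_k, U_{k+1}, B),
  another is the expression in the curly bracket {...}. The integral in (2.12) defines the new term E^{(k+1)} in the
  inductive definition of the action A_{k+1} by the formula E^{(k+1)}(g_k, U_{k+1}) = log ∫ dμ_{C^{(k)}}(B)χ_k
  exp[P^{(k)}(g_k, U_{k+1}, B) + {...}]. (2.13) Let us remark that the expression under the exponential above vanishes
  at g_k = 0, and log N″_k = E^{(k+1)}(g_k, 1). (2.14)"* … *"By the inductive assumption, and by the properties of the
  expressions given by explicit formulas, all terms in this representation satisfy the required properties, except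
  possibly the last term (2.13) in the sum."*
* p. 298 [PDF 50]: *"We write β_j as explicitly dependent on g_{j−1}, although it depends also on all preceding coupling
  constants."* — the ONLY printed sentence on the history dependence; NO continuity of `E^{(j)}`, `Π_j` or `β_j` in the
  preceding coupling constants is stated anywhere in [I].

WHAT THIS MODULE DOES.  The row's open cell (C) = `FlowStep.BetaContH γ β` was reduced in `…Beta.BetaContinuity` /
`…Beta.BetaContinuityVolume` to (C-fin) — for each scale `k`, torus `T_t` and torus site `x`, the FINITE-VOLUME kernel
entry `v = (g_0,…,g_k) ↦ Π^{T_t}_{k+1,μν}(v; x)` is continuous on the box `]0,γ]^{k+1}` — plus the located input (VR-u).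
(C-fin) is a statement about a DERIVATIVE at zero external field ((1.20)) of the finite-volume generating function
`B ↦ E^{(k+1),T}(v; U_{k+1}(exp iB))`, whose history dependence is INDUCTIVE ((2.13): the old terms `E^{(j)}`, `j ≤ k`,
enter through the curly bracket).  This module reduces (C-fin) [kernel] to clauses of PRINTED TYPE about VALUES:
(A) CAUCHY TRANSFER (§§1–2): for a family `E_v` of functions analytic on a fixed ball `‖B‖ < α` and bounded by `S` on
    `‖B‖ ≤ ρ < α` UNIFORMLY in the parameter `v` (the (1.5)/(1.17) domain and a (1.18)-type bound), continuity in `v` of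
    the VALUES `E_v(B)` for each fixed `B` implies continuity in `v` of the first and mixed second derivatives at `0`
    (Cauchy's formula on fixed circles + dominated convergence); and, since (2.13) controls the INTEGRAL `exp E^{(k+1)}`
    rather than `E^{(k+1)}`, the same with the values of `Z_v = exp E_v` as input — the (1.20) second derivative of
    `E = log Z` being the branch-free combination `logPol Z = ∂∂Z/Z − ∂Z·∂Z/Z²` (`logPol_exp`).  NO complex logarithm is
    ever taken.
(B) THE (2.13) TOWER (§4): per sequence of lattices, the exponentiated recursion `exp E^{(k+1)}(v; U) = ∫ dμ χ_k
    exp[P^{(k)} + {…}]` with `exp{…} = Π_{j<k} exp E^{(j+1)}(v|_j; σ_{kj}) / exp E^{(j+1)}(v|_j; τ_{kj})` gives, by strong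
    induction on `k` and dominated convergence AT EACH POINT, joint continuity of `(v, U) ↦ exp E^{(k+1)}(v; U)` on
    `]0,γ]^{k+1} × D_k` from: an integrable dominating function, continuity of the explicit data `P^{(k)}`, `σ`, `τ` in
    `(g_k, U)`, and the NULL-BOUNDARY clause for the cutoff — the (2.9) cutoff `χ({|B′(b)| < ε₁})` reads, in the final
    integration variables, `|(g_kCB − hD̃(g_kCB))(b)| < ε₁` (the combination of (2.12)): it MOVES with `g_k`, is locally
    constant in `g_k` off the level sets `|…| = ε₁`, and those are `dμ`-null for each fixed `g_k` (Gaussian measure) — a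
    null set DEPENDING on the point, whence Mathlib's pointwise `continuousWithinAt_of_dominated`, not `continuousOn_of_
    dominated`.  This is where the history channel lives: `(g_0,…,g_{k−1})` enters ONLY through the old terms.
(C) ASSEMBLY (§§3, 5): towers per torus + field maps `B ↦ U_{k+1}(exp iB)` + printed-type analyticity/bounds in `B` +
    the (1.20)–(1.21) dictionary for the torus REMAINDER kernels (`= Re ∂_{μ,x}∂_{ν,0}E^{(k+1),T}` up to a history-free
    term, the one-loop torus kernel) ⇒ (C-fin) ⇒ (C) via `betaContH_of_chain_volumeRate` ⇒ the two END statements.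

CONTENT (every `theorem` kernel-checked; [folklore]; nothing is asserted about Bałaban's objects):
1. `continuousOn_deriv_of_forall_mem_sphere` (one complex variable), `continuousOn_fderiv_apply`,
   `continuousOn_mixedDeriv` — (A) for `E_v` itself.
2. `logPol`, `logPol_exp`, `continuousOn_mixedDeriv_of_exp`, `continuousOn_re_mixedDeriv_of_exp` — (A) from `exp E_v`.
3. `cfin_of_expValues` — (C-fin) (the clause `hfin` of `BetaContinuityVolume.betaContH_of_chain_volumeRate`) from the
   dictionary `hrepr`, analyticity `han`, bounds `hbd` and exponentiated-value continuity `hval`.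
4. `pref`, `integrand213`, `Tower213` (structure: data χ, P, σ, τ, bound; clauses eq213 / meas / dom / integrable /
   cutoff / contP / contσ / mapsσ / contτ / mapsτ, each tagged in its docstring), `Tower213.step`,
   `Tower213.continuousOn_exp` (THE TOWER THEOREM), `Tower213.continuousOn_exp_at`.
5. `hval_of_towers`, `betaContH_of_chain_towers`, `thm2Printed_of_remainderChain_towers`,
   `endpointExistence_of_remainderChain_towers`.
6. Non-vacuity: a (trivial) `Tower213` instance, so the clause set is simultaneously satisfiable.

HONEST FRAMING.  The tower clauses, the field-map/analyticity/bound clauses and the (1.20) dictionary are LOCATED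
INPUTS OF PRINTED TYPE ((1.5)/(1.17)/(1.18), (2.9), (2.12)–(2.14), (1.20)–(1.21)) or routine finite-dimensional
analysis (measurability, domination, Gaussian null level sets), carried as hypotheses/structure fields (used only to the
left of `→`), never facts; NONE of them is a continuity statement about `β`, `Π` or any `E^{(j)}` — those are OUTPUTS
here.  What this module does NOT touch: (VR-u) (row pv10, `LocalizedVolumeRate`), the leaves inside the remainder chain
(row an4's located loci), the one-loop sign (AF-0)/(M2) — the sub-cell's wall (BETA-SPEC §6–§7).  Discharging the flow
input `BetaPertH` (via its replacements) would make Bałaban's UV stability UNCONDITIONAL — a real constructive-QFT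
result; it is NOT the continuum limit and NOT the Clay problem.  (Gloss 1, BETA-SPEC v1.8d l. 17–22, GAPS G-ref2-14 (a) /
G-ref2-20 (a) / G-ref2-23 (a) / G-ref2-24 (a), verbatim: «UNCONDITIONAL» in [Balaban1989LargeFieldII] (B16) p. 355's
interval-hypothesis sense ONLY (`FlowStepRuns.p355Unconditional_of_partialSums` keeps `hnodes`); the located leaves
G-adv3-2 (left inequality of (0.1)/(2.50), d = 4), G-adv3-1 (U2 transfer of B14 Cor. 3's lower bound) and `SecondExpLeaf`
REMAIN.  Gloss 2, BETA-SPEC v1.9e l. 23–25, beta-ref C-beta-78, BINDING: «UNCONDITIONAL» =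
`Beta.Assembly.EventualForm`-unconditional — the END statement with the interval hypothesis removed, (0.31) in DEFECTED
form on all lattices (`PrefixAbsorption.thm2Defected_of_eventualForm`), admissible couplings shrunk to g ≤ g⋆; NOT «B12
Theorem 2 as printed» (`eventualForm_not_thm2Printed`, RULING (R6)); never the continuum limit / mass gap / Clay.  In
particular `thm2Printed_of_remainderChain_towers` below reaches `B12.Thm2Printed` only FROM its (AF-0s)-type sign and
smallness binders `hAF0 : ∀ k, 2 * b ≤ S.β0 k`, `hε₁`, which no printed source supplies.)  Value = kernel bookkeeping (the row's continuity residual moved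
from derivatives of limit objects to value-level clauses of printed type), NOT summit progress.

v1.0.1 (DOCFIX, header only, every declaration byte-unchanged; an4 lineage gen 4, pre-empting the G-ref2-23 (a) / G-ref2-24 (a)
class for a module landed 22:55Z, after gloss 2 became BINDING at 22:38Z): glosses 1 AND 2 carried verbatim above (model
`Beta/HomogSmoothTransverse` l. 8–14); XREAD C-pv26g3-8 (boundary clean; record-only remarks R1 `contP` includes the
continuity of the covariance density absorbed into `P k`, R2 `eq213` is (2.13) continued to complex `U` — both declared in
the `Tower213` docstring) unaffected; no declaration changed.
-/

namespace Literature.MathematicalPhysics.QuantumFieldTheory.Balaban1983to89.Beta.HistoryContinuity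

open Literature.MathematicalPhysics.QuantumFieldTheory.Balaban1983to89
open Literature.MathematicalPhysics.QuantumFieldTheory.Balaban1983to89.B12Decay510 (mixedDeriv)
open _root_.Filter _root_.Metric _root_.Complex _root_.MeasureTheory
open scoped _root_.Topology _root_.Real

noncomputable section

/-! ## 1. Cauchy transfer: continuity of derivatives in a parameter from POINTWISE continuity of values -/

section Cauchy

variable {X : Type*} [TopologicalSpace X] [FirstCountableTopology X] {s : Set X}

/-- **One complex variable.**  `g v` differentiable on the closed disc `‖τ‖ ≤ r`, `‖g v τ‖ ≤ M` on the circle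
`‖τ‖ = r` uniformly in `v ∈ s`, and `v ↦ g v τ` continuous on `s` for every `τ` on that circle ⇒ `v ↦ (g v)′(0)` is
continuous on `s`.  Cauchy's formula `(g v)′(0) = (2πi)⁻¹∮_{‖τ‖=r} τ⁻² g v τ dτ` (Mathlib
`DifferentiableOn.deriv_eq_smul_circleIntegral`) and dominated convergence for the circle integral (Mathlib
`intervalIntegral.continuousWithinAt_of_dominated_interval`). [folklore] -/
theorem continuousOn_deriv_of_forall_mem_sphere {g : X → ℂ → ℂ} {r M : ℝ} (hr : 0 < r)
    (hd : ∀ v ∈ s, DifferentiableOn ℂ (g v) (closedBall 0 r))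
    (hM : ∀ v ∈ s, ∀ τ ∈ sphere (0 : ℂ) r, ‖g v τ‖ ≤ M)
    (hpt : ∀ τ ∈ sphere (0 : ℂ) r, ContinuousOn (fun v => g v τ) s) :
    ContinuousOn (fun v => deriv (g v) 0) s := by
  set F : X → ℝ → ℂ := fun v θ =>
    deriv (circleMap 0 r) θ • ((1 / circleMap 0 r θ ^ 2) • g v (circleMap 0 r θ)) with hF
  set bound : ℝ → ℝ := fun θ => ‖deriv (circleMap 0 r) θ‖ * (‖(1 : ℂ) / circleMap 0 r θ ^ 2‖ * M)
    with hbound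
  have h1 : Continuous fun θ : ℝ => deriv (circleMap 0 r) θ := by
    simp only [deriv_circleMap]; fun_prop
  have h2 : Continuous fun θ : ℝ => (1 : ℂ) / circleMap 0 r θ ^ 2 :=
    continuous_const.div ((continuous_circleMap 0 r).pow 2) fun θ => pow_ne_zero _ (circleMap_ne_center hr.ne')
  have hFc : ∀ v ∈ s, Continuous (F v) := by
    intro v hv
    have h3 : Continuous fun θ : ℝ => g v (circleMap 0 r θ) :=
      (hd v hv).continuousOn.comp_continuous (continuous_circleMap 0 r)
        fun θ => circleMap_mem_closedBall 0 hr.le θ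
    exact h1.smul (h2.smul h3)
  have hbc : Continuous bound := h1.norm.mul (h2.norm.mul continuous_const)
  have hFle : ∀ v ∈ s, ∀ θ : ℝ, ‖F v θ‖ ≤ bound θ := by
    intro v hv θ
    have hg := hM v hv (circleMap 0 r θ) (circleMap_mem_sphere 0 hr.le θ)
    simp only [hF, hbound, norm_smul]
    gcongr
  have hΦ : ContinuousOn (fun v => ∮ z in C(0, r), (1 / z ^ 2) • g v z) s := by
    intro v₀ hv₀
    show ContinuousWithinAt (fun v => ∫ θ in (0 : ℝ)..2 * π, F v θ) s v₀
    refine intervalIntegral.continuousWithinAt_of_dominated_interval (bound := bound) ?_ ?_ ?_ ?_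
    · exact eventually_nhdsWithin_of_forall fun v hv => (hFc v hv).aestronglyMeasurable
    · exact eventually_nhdsWithin_of_forall fun v hv => Eventually.of_forall fun θ _ => hFle v hv θ
    · exact hbc.intervalIntegrable _ _
    · refine Eventually.of_forall fun θ _ => ?_
      have h := (hpt (circleMap 0 r θ) (circleMap_mem_sphere 0 hr.le θ)) v₀ hv₀
      simp only [hF]
      exact (continuousWithinAt_const (b := deriv (circleMap 0 r) θ)).smul
        ((continuousWithinAt_const (b := (1 : ℂ) / circleMap 0 r θ ^ 2)).smul h)
  have key : ∀ v ∈ s, deriv (g v) 0 = (2 * π * I)⁻¹ • ∮ z in C(0, r), (1 / z ^ 2) • g v z := by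
    intro v hv
    have h := (hd v hv).deriv_eq_smul_circleIntegral hr
    simp only [sub_zero] at h
    rw [h, inv_smul_smul₀ two_pi_I_ne_zero]
  exact (hΦ.const_smul ((2 * π * I)⁻¹)).congr fun v hv => key v hv

variable {W : Type*} [NormedAddCommGroup W] [NormedSpace ℂ W]

/-- **A directional derivative** `∂_a E_v(p) = D(E v)(p) a` at a point `‖p‖ ≤ ρ/2` is continuous in the parameter `v` on
`s`, provided each `E v` is analytic on the ball `‖w‖ < α` ((4.4)-type domain), `‖E v w‖ ≤ S` on the closed ball
`‖w‖ ≤ ρ < α` uniformly in `v ∈ s` ((1.18)-type bound), and the VALUES `v ↦ E v w` are continuous on `s` for every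
fixed `w` of that closed ball.  (The complex line `p + τa`, `‖τ‖ ≤ ρ/(2‖a‖)`, stays in the closed ball; §1's
one-variable statement applies to `τ ↦ E v (p + τa)`, whose derivative at 0 is `D(E v)(p) a`.) [folklore] -/
theorem continuousOn_fderiv_apply {E : X → W → ℂ} {α ρ S : ℝ}
    (hE : ∀ v ∈ s, AnalyticOnNhd ℂ (E v) (ball 0 α)) (hρ : 0 < ρ) (hρα : ρ < α)
    (hS : ∀ v ∈ s, ∀ w ∈ closedBall (0 : W) ρ, ‖E v w‖ ≤ S)
    (hpt : ∀ w ∈ closedBall (0 : W) ρ, ContinuousOn (fun v => E v w) s)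
    {p : W} (hp : ‖p‖ ≤ ρ / 2) (a : W) :
    ContinuousOn (fun v => fderiv ℂ (E v) p a) s := by
  by_cases ha : a = 0
  · subst ha; simp only [map_zero]; exact continuousOn_const
  have ha' : 0 < ‖a‖ := norm_pos_iff.2 ha
  set r₁ : ℝ := ρ / (2 * ‖a‖) with hr₁
  have hr₁0 : 0 < r₁ := div_pos hρ (by positivity)
  have hin : ∀ τ : ℂ, ‖τ‖ ≤ r₁ → p + τ • a ∈ closedBall (0 : W) ρ := by
    intro τ hτ
    rw [mem_closedBall, dist_zero_right]
    calc ‖p + τ • a‖ ≤ ‖p‖ + ‖τ • a‖ := norm_add_le _ _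
      _ = ‖p‖ + ‖τ‖ * ‖a‖ := by rw [norm_smul]
      _ ≤ ρ / 2 + r₁ * ‖a‖ := by gcongr
      _ = ρ := by rw [hr₁]; field_simp; ring
  have hball : closedBall (0 : W) ρ ⊆ ball 0 α := closedBall_subset_ball hρα
  have hp0 : p ∈ closedBall (0 : W) ρ := by simpa using hin 0 (by simp [hr₁0.le])
  have hA := continuousOn_deriv_of_forall_mem_sphere (s := s) (g := fun v τ => E v (p + τ • a)) (M := S)
    hr₁0 ?_ ?_ ?_
  · refine hA.congr fun v hv => ?_
    have hdiff : DifferentiableAt ℂ (E v) p := (hE v hv _ (hball hp0)).differentiableAt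
    exact ((Literature.Analysis.Complex.SCV.hasDerivAt_slice_zero hdiff a).deriv).symm
  · intro v hv τ hτ
    rw [mem_closedBall, dist_zero_right] at hτ
    have hdτ : DifferentiableAt ℂ (E v) (p + τ • a) := (hE v hv _ (hball (hin τ hτ))).differentiableAt
    exact (hdτ.comp τ ((differentiableAt_id.smul_const a).const_add p)).differentiableWithinAt
  · intro v hv τ hτ
    rw [mem_sphere, dist_zero_right] at hτ
    exact hS v hv _ (hin τ hτ.le)
  · intro τ hτ
    rw [mem_sphere, dist_zero_right] at hτ
    exact hpt _ (hin τ hτ.le)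

/-- **The (4.3) mixed derivative** `∂²/∂τ₁∂τ₂ E_v(τ₁a + τ₂b)∣₀` (`B12Decay510.mixedDeriv (E v) a b`, the object of the
tree's (4.35)/(1.20) dictionaries) is continuous in the parameter `v` on `s` under the same three hypotheses:
analyticity of each `E v` on `‖w‖ < α`, a `v`-uniform bound on `‖w‖ ≤ ρ < α`, and POINTWISE continuity of the values
`v ↦ E v w` for `‖w‖ ≤ ρ`.  Two nested applications of the one-variable statement on the circles
`‖τ₁‖ = ρ/(2‖a‖)`, `‖τ₂‖ = ρ/(2‖b‖)` (so that `‖τ₁a + τ₂b‖ ≤ ρ`), the inner uniform bound being the Cauchy estimate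
`‖D(E v)(τ₂b) a‖ ≤ S·(2‖a‖/ρ)` (`Literature.Analysis.Complex.SCV.norm_fderiv_apply_le`).  This is the kernel of the
reduction "continuity of the (1.20) DERIVATIVES in the coupling history ⇐ continuity of the VALUES": derivatives at
`A = 0` of a uniformly bounded analytic family inherit pointwise parameter-continuity from the values. [folklore] -/
theorem continuousOn_mixedDeriv {E : X → W → ℂ} {α ρ S : ℝ}
    (hE : ∀ v ∈ s, AnalyticOnNhd ℂ (E v) (ball 0 α)) (hρ : 0 < ρ) (hρα : ρ < α)
    (hS : ∀ v ∈ s, ∀ w ∈ closedBall (0 : W) ρ, ‖E v w‖ ≤ S)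
    (hpt : ∀ w ∈ closedBall (0 : W) ρ, ContinuousOn (fun v => E v w) s) (a b : W) :
    ContinuousOn (fun v => mixedDeriv (E v) a b) s := by
  by_cases ha : a = 0
  · subst ha
    exact (continuousOn_const (c := (0 : ℂ))).congr fun v _ => by simp [mixedDeriv]
  by_cases hb : b = 0
  · subst hb
    exact (continuousOn_const (c := (0 : ℂ))).congr fun v _ => by simp [mixedDeriv]
  have ha' : 0 < ‖a‖ := norm_pos_iff.2 ha
  have hb' : 0 < ‖b‖ := norm_pos_iff.2 hb
  set r₁ : ℝ := ρ / (2 * ‖a‖) with hr₁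
  set r₂ : ℝ := ρ / (2 * ‖b‖) with hr₂
  have hr₁0 : 0 < r₁ := div_pos hρ (by positivity)
  have hr₂0 : 0 < r₂ := div_pos hρ (by positivity)
  have hball : closedBall (0 : W) ρ ⊆ ball 0 α := closedBall_subset_ball hρα
  have hin : ∀ τ₁ τ₂ : ℂ, ‖τ₁‖ ≤ r₁ → ‖τ₂‖ ≤ r₂ → τ₂ • b + τ₁ • a ∈ closedBall (0 : W) ρ := by
    intro τ₁ τ₂ h1 h2
    rw [mem_closedBall, dist_zero_right]
    calc ‖τ₂ • b + τ₁ • a‖ ≤ ‖τ₂ • b‖ + ‖τ₁ • a‖ := norm_add_le _ _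
      _ = ‖τ₂‖ * ‖b‖ + ‖τ₁‖ * ‖a‖ := by rw [norm_smul, norm_smul]
      _ ≤ r₂ * ‖b‖ + r₁ * ‖a‖ := by gcongr
      _ = ρ := by rw [hr₁, hr₂]; field_simp; ring
  have hτb : ∀ τ₂ : ℂ, ‖τ₂‖ ≤ r₂ → ‖τ₂ • b‖ ≤ ρ / 2 := by
    intro τ₂ h2
    rw [norm_smul]
    calc ‖τ₂‖ * ‖b‖ ≤ r₂ * ‖b‖ := by gcongr
      _ = ρ / 2 := by rw [hr₂]; field_simp
  -- inner: pointwise continuity and the Cauchy bound of `v ↦ D(E v)(τ₂ b) a` on the closed disc `‖τ₂‖ ≤ r₂`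
  have inner_cont : ∀ τ₂ : ℂ, ‖τ₂‖ ≤ r₂ → ContinuousOn (fun v => fderiv ℂ (E v) (τ₂ • b) a) s :=
    fun τ₂ h2 => continuousOn_fderiv_apply hE hρ hρα hS hpt (hτb τ₂ h2) a
  have inner_bd : ∀ v ∈ s, ∀ τ₂ : ℂ, ‖τ₂‖ ≤ r₂ → ‖fderiv ℂ (E v) (τ₂ • b) a‖ ≤ S / r₁ := by
    intro v hv τ₂ h2
    refine Literature.Analysis.Complex.SCV.norm_fderiv_apply_le (hE v hv).differentiableOn isOpen_ball hr₁0
      (fun t ht => hball (hin t τ₂ ?_ h2)) (fun t ht => hS v hv _ (hin t τ₂ ?_ h2))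
    · rwa [mem_closedBall, dist_zero_right] at ht
    · rw [mem_sphere, dist_zero_right] at ht
      exact ht.le
  -- outer: the one-variable statement for `τ₂ ↦ D(E v)(τ₂ b) a` on `‖τ₂‖ ≤ r₂`
  have outer := continuousOn_deriv_of_forall_mem_sphere (s := s) (g := fun v τ => fderiv ℂ (E v) (τ • b) a)
    (M := S / r₁) hr₂0 ?_ ?_ ?_
  · simpa only [mixedDeriv] using outer
  · intro v hv τ₂ h2
    rw [mem_closedBall, dist_zero_right] at h2
    have hp : τ₂ • b ∈ ball (0 : W) α := hball (by simpa using hin 0 τ₂ (by simp [hr₁0.le]) h2)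
    have hG : DifferentiableAt ℂ (fun τ : ℂ => fderiv ℂ (E v) (τ • b)) τ₂ :=
      ((hE v hv _ hp).fderiv.differentiableAt).comp τ₂ (differentiableAt_id.smul_const b)
    exact (hG.clm_apply (differentiableAt_const a)).differentiableWithinAt
  · intro v hv τ₂ h2
    rw [mem_sphere, dist_zero_right] at h2
    exact inner_bd v hv τ₂ h2.le
  · intro τ₂ h2
    rw [mem_sphere, dist_zero_right] at h2
    exact inner_cont τ₂ h2.le

end Cauchy

/-! ## 2. The logarithmic form: derivatives of `E = log Z` from the values of `Z = exp E` -/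

section LogPol

variable {W : Type*} [NormedAddCommGroup W] [NormedSpace ℂ W]

/-- The second logarithmic derivative in the directions `a, b` at `0`, written on `Z` itself:
`logPol Z a b = ∂_a∂_b Z(0)/Z(0) − ∂_aZ(0)·∂_bZ(0)/Z(0)²` — for `Z = exp E` this IS `∂_a∂_b E(0)`
(`logPol_exp`), i.e. the (1.20) second derivative of `E = log Z` computed WITHOUT choosing a branch of `log`. [folklore] -/
def logPol (Z : W → ℂ) (a b : W) : ℂ :=
  mixedDeriv Z a b / Z 0 - fderiv ℂ Z 0 a * fderiv ℂ Z 0 b / Z 0 ^ 2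

/-- `logPol (exp ∘ T) a b = mixedDeriv T a b` for `T` analytic near `0`: the calculus identity
`∂_a∂_b log Z = ∂_a∂_b Z/Z − ∂_aZ ∂_bZ/Z²` at `Z = e^T` (chain and product rules; Mathlib `HasDerivAt.cexp`,
`HasFDerivAt.cexp`). [folklore] -/
theorem logPol_exp {T : W → ℂ} {α : ℝ} (hα : 0 < α) (hT : AnalyticOnNhd ℂ T (ball 0 α)) (a b : W) :
    logPol (fun w => Complex.exp (T w)) a b = mixedDeriv T a b := by
  have h0 : (0 : W) ∈ ball (0 : W) α := mem_ball_self hα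
  -- first derivatives of `exp ∘ T`
  have hfd : ∀ p ∈ ball (0 : W) α, fderiv ℂ (fun w => Complex.exp (T w)) p = Complex.exp (T p) • fderiv ℂ T p :=
    fun p hp => ((hT p hp).differentiableAt.hasFDerivAt.cexp).fderiv
  -- the slice `τ ↦ τ • b` and the derivative of `τ ↦ T (τ • b)` at `0`
  have hl : HasDerivAt (fun τ : ℂ => τ • b) b 0 := by simpa using (hasDerivAt_id (0 : ℂ)).smul_const b
  have hTl : HasDerivAt (fun τ : ℂ => T (τ • b)) (fderiv ℂ T 0 b) 0 :=
    HasFDerivAt.comp_hasDerivAt_of_eq (hl := (hT 0 h0).differentiableAt.hasFDerivAt) (hf := hl) (hy := by simp)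
  have hexp : HasDerivAt (fun τ : ℂ => Complex.exp (T (τ • b))) (Complex.exp (T 0) * fderiv ℂ T 0 b) 0 := by
    simpa using hTl.cexp
  -- `τ ↦ D T(τ b) a` is differentiable at `0` with derivative `mixedDeriv T a b`
  have hG : DifferentiableAt ℂ (fun τ : ℂ => fderiv ℂ T (τ • b) a) 0 := by
    have h0b : (0 : ℂ) • b ∈ ball (0 : W) α := by simpa using h0
    have h1 : DifferentiableAt ℂ (fun τ : ℂ => fderiv ℂ T (τ • b)) 0 :=
      ((hT _ h0b).fderiv.differentiableAt).comp 0 (differentiableAt_id.smul_const b)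
    exact h1.clm_apply (differentiableAt_const a)
  have hF : HasDerivAt (fun τ : ℂ => fderiv ℂ T (τ • b) a) (mixedDeriv T a b) 0 := hG.hasDerivAt
  -- near `τ = 0` the point `τ • b` lies in the ball, so `D(exp∘T)(τ b) a = exp(T(τ b)) · D T(τ b) a` there
  have hev : ∀ᶠ τ in 𝓝 (0 : ℂ), τ • b ∈ ball (0 : W) α :=
    (isOpen_ball.preimage (continuous_id.smul continuous_const)).mem_nhds (by simpa using hα)
  have hEq : (fun τ : ℂ => fderiv ℂ (fun w => Complex.exp (T w)) (τ • b) a) =ᶠ[𝓝 0]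
      fun τ => Complex.exp (T (τ • b)) * fderiv ℂ T (τ • b) a :=
    hev.mono fun τ hτ => by
      show fderiv ℂ (fun w => Complex.exp (T w)) (τ • b) a = Complex.exp (T (τ • b)) * fderiv ℂ T (τ • b) a
      rw [hfd _ hτ]; simp [smul_eq_mul]
  have hprod : HasDerivAt (fun τ : ℂ => Complex.exp (T (τ • b)) * fderiv ℂ T (τ • b) a)
      (Complex.exp (T 0) * fderiv ℂ T 0 b * fderiv ℂ T ((0 : ℂ) • b) a
        + Complex.exp (T ((0 : ℂ) • b)) * mixedDeriv T a b) 0 :=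
    hexp.mul hF
  have hprod' := hprod.deriv
  simp only [zero_smul] at hprod'
  have hmix : mixedDeriv (fun w => Complex.exp (T w)) a b =
      Complex.exp (T 0) * fderiv ℂ T 0 b * fderiv ℂ T 0 a + Complex.exp (T 0) * mixedDeriv T a b := by
    change deriv (fun τ : ℂ => fderiv ℂ (fun w => Complex.exp (T w)) (τ • b) a) 0 = _
    rw [hEq.deriv_eq, hprod']
  have ha : fderiv ℂ (fun w => Complex.exp (T w)) 0 a = Complex.exp (T 0) * fderiv ℂ T 0 a := by
    rw [hfd 0 h0]; simp [smul_eq_mul]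
  have hb : fderiv ℂ (fun w => Complex.exp (T w)) 0 b = Complex.exp (T 0) * fderiv ℂ T 0 b := by
    rw [hfd 0 h0]; simp [smul_eq_mul]
  have hne : Complex.exp (T 0) ≠ 0 := Complex.exp_ne_zero _
  simp only [logPol, hmix, ha, hb]
  field_simp
  ring

variable {X : Type*} [TopologicalSpace X] [FirstCountableTopology X] {s : Set X}

/-- **Derivatives of `E` from the values of `Z = exp E`.**  For a family `T v : W → ℂ` (`v ∈ s`) of analytic
functions on `‖w‖ < α`, bounded by `S` on `‖w‖ ≤ ρ < α` uniformly in `v`, whose EXPONENTIATED VALUES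
`v ↦ exp (T v w)` are continuous on `s` for each `‖w‖ ≤ ρ`, the mixed derivative `v ↦ mixedDeriv (T v) a b` is
continuous on `s`.  (`mixedDeriv (T v) a b = logPol (exp ∘ T v) a b`; §1 applied to the bounded analytic family
`exp ∘ T v` — bound `e^S`, never zero.)  This is the form in which the (2.13) recursion — which controls
`exp E^{(k+1)}`, an INTEGRAL, not `E^{(k+1)}` itself — feeds the (1.20) derivatives. [folklore] -/
theorem continuousOn_mixedDeriv_of_exp {T : X → W → ℂ} {α ρ S : ℝ}
    (hT : ∀ v ∈ s, AnalyticOnNhd ℂ (T v) (ball 0 α)) (hρ : 0 < ρ) (hρα : ρ < α)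
    (hS : ∀ v ∈ s, ∀ w ∈ closedBall (0 : W) ρ, ‖T v w‖ ≤ S)
    (hZ : ∀ w ∈ closedBall (0 : W) ρ, ContinuousOn (fun v => Complex.exp (T v w)) s) (a b : W) :
    ContinuousOn (fun v => mixedDeriv (T v) a b) s := by
  have hα : 0 < α := hρ.trans hρα
  set Z : X → W → ℂ := fun v w => Complex.exp (T v w) with hZdef
  have hZan : ∀ v ∈ s, AnalyticOnNhd ℂ (Z v) (ball 0 α) := fun v hv => (hT v hv).cexp
  have hZS : ∀ v ∈ s, ∀ w ∈ closedBall (0 : W) ρ, ‖Z v w‖ ≤ Real.exp S := by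
    intro v hv w hw
    simp only [hZdef, Complex.norm_exp]
    exact Real.exp_le_exp.2 ((Complex.re_le_norm _).trans (hS v hv w hw))
  have h0 : (0 : W) ∈ closedBall (0 : W) ρ := by simp [hρ.le]
  have hM := continuousOn_mixedDeriv hZan hρ hρα hZS hZ a b
  have hp0 : ‖(0 : W)‖ ≤ ρ / 2 := by rw [norm_zero]; positivity
  have hDa := continuousOn_fderiv_apply hZan hρ hρα hZS hZ hp0 a
  have hDb := continuousOn_fderiv_apply hZan hρ hρα hZS hZ hp0 b
  have hZ0 : ContinuousOn (fun v => Z v 0) s := hZ 0 h0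
  have hne : ∀ v ∈ s, Z v 0 ≠ 0 := fun v _ => Complex.exp_ne_zero _
  have hne2 : ∀ v ∈ s, Z v 0 ^ 2 ≠ 0 := fun v hv => pow_ne_zero _ (hne v hv)
  have hL : ContinuousOn (fun v => logPol (Z v) a b) s :=
    (hM.div hZ0 hne).sub ((hDa.mul hDb).div (hZ0.pow 2) hne2)
  exact hL.congr fun v hv => (logPol_exp hα (hT v hv) a b).symm

/-- Real parts (the tree's kernels are the real parts of the (1.20) derivatives, cf. `B12Decay510` §8). [folklore] -/
theorem continuousOn_re_mixedDeriv_of_exp {T : X → W → ℂ} {α ρ S : ℝ}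
    (hT : ∀ v ∈ s, AnalyticOnNhd ℂ (T v) (ball 0 α)) (hρ : 0 < ρ) (hρα : ρ < α)
    (hS : ∀ v ∈ s, ∀ w ∈ closedBall (0 : W) ρ, ‖T v w‖ ≤ S)
    (hZ : ∀ w ∈ closedBall (0 : W) ρ, ContinuousOn (fun v => Complex.exp (T v w)) s) (a b : W) :
    ContinuousOn (fun v => (mixedDeriv (T v) a b).re) s :=
  Complex.continuous_re.comp_continuousOn (continuousOn_mixedDeriv_of_exp hT hρ hρα hS hZ a b)

end LogPol

/-! ## 3. (C-fin) from EXPONENTIATED VALUES of the finite-volume generating functions -/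

section Values

open Literature.MathematicalPhysics.QuantumFieldTheory.Balaban1983to89.FlowStep

variable {d : ℕ} {side : ℕ → ℕ → ℕ}
variable {V : ℕ → ℕ → Type*} [∀ k t, NormedAddCommGroup (V k t)] [∀ k t, NormedSpace ℂ (V k t)]

/-- **(C-fin) ⇐ (1.20) dictionary + printed-type analyticity/bound + continuity of the exponentiated VALUES.**
At scale `k`, torus `t`: `T k t v : V k t → ℂ` is the finite-volume generating function of the complex external field,
`B ↦ E^{(k+1),T_t}(g_0,…,g_k; U_{k+1}(exp iB))` (p. 264: *"Let us denote E^{(j+1)}(g_j, B) = E^{(j+1)}(g_j,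
U_{j+1}(exp iB))"*), analytic on `‖B‖ < α k t` ((1.5)/(1.17)-type domain, p. 263: *"defined and analytic on the space
U^c_j(X, α₀, α₁)"*) and bounded by `S k t` on `‖B‖ ≤ ρ k t` uniformly in the history ((1.18)-type; per `(k,t)`
constants suffice here); `e k t μ x` = the direction `δ/δB_μ(x)` (fixed colour), so that by (1.20)–(1.21) the torus
kernel is `Re ∂_{e μ x}∂_{e ν 0} T k t v` up to a HISTORY-FREE term `Q k t x` (for the remainder kernel `Π¹ = Π − Π⁰`:
`Q = −Π^{0,T}`, the one-loop torus kernel; for the full kernel `Q = 0`) — hypothesis `hrepr`; and the exponentiated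
values `v ↦ exp T k t v B` are continuous on the box for each `‖B‖ ≤ ρ k t` — hypothesis `hval`, the output of the
(2.13) tower of §4 (`hval_of_towers`).  Conclusion = the clause `hfin` of
`BetaContinuityVolume.betaContH_of_chain_volumeRate` (and, with an extra index, `LocalizedFamily.cont_term`).
[cite: Balaban1987RG1, (1.20)-(1.21) p.264 and (1.18) p.263] -/
theorem cfin_of_expValues {γ : ℝ} (μ ν : Fin d)
    (PT : (k t : ℕ) → (Fin (k + 1) → ℝ) → Fin d → Fin d → Site d (side k t) → ℝ)
    (T : (k t : ℕ) → (Fin (k + 1) → ℝ) → V k t → ℂ) (e : (k t : ℕ) → Fin d → Site d (side k t) → V k t)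
    (Q : (k t : ℕ) → Site d (side k t) → ℝ) (α ρ S : ℕ → ℕ → ℝ)
    (hρ : ∀ k t, 0 < ρ k t) (hρα : ∀ k t, ρ k t < α k t)
    (han : ∀ k t, ∀ v ∈ Box γ k, AnalyticOnNhd ℂ (T k t v) (ball 0 (α k t)))
    (hbd : ∀ k t, ∀ v ∈ Box γ k, ∀ w ∈ closedBall (0 : V k t) (ρ k t), ‖T k t v w‖ ≤ S k t)
    (hval : ∀ k t, ∀ w ∈ closedBall (0 : V k t) (ρ k t),
      ContinuousOn (fun v => Complex.exp (T k t v w)) (Box γ k))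
    (hrepr : ∀ k t, ∀ v ∈ Box γ k, ∀ x,
      PT k t v μ ν x = (mixedDeriv (T k t v) (e k t μ x) (e k t ν 0)).re + Q k t x) :
    ∀ k t (x : Site d (side k t)), ContinuousOn (fun v => PT k t v μ ν x) (Box γ k) := by
  intro k t x
  have h := (continuousOn_re_mixedDeriv_of_exp (han k t) (hρ k t) (hρα k t) (hbd k t) (hval k t)
    (e k t μ x) (e k t ν 0)).add (continuousOn_const (c := Q k t x))
  exact h.congr fun v hv => hrepr k t v hv x

end Values

/-! ## 4. The (2.13) tower: joint continuity of `exp E^{(k+1)}(g_0,…,g_k; U)` in (history, configuration) -/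

section Tower

open Literature.MathematicalPhysics.QuantumFieldTheory.Balaban1983to89.FlowStep

variable {Wc : ℕ → Type*} [∀ k, TopologicalSpace (Wc k)] [∀ k, FirstCountableTopology (Wc k)]
variable {Ω : ℕ → Type*} [∀ k, MeasurableSpace (Ω k)]

/-- The prefix `(g_0,…,g_j)` of a history `(g_0,…,g_k)`, `j < k` — the arguments of the OLD term `E^{(j+1)}` inside
the curly bracket of (2.12)/(2.13) (p. 298: *"We write β_j as explicitly dependent on g_{j-1}, although it depends
also on all preceding coupling constants"* — the same convention for `E^{(j)}`, (1.7) p. 261). [cite: Balaban1987RG1, §5 p.298 (last paragraph)] -/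
def pref {k : ℕ} (v : Fin (k + 1) → ℝ) (j : Fin k) : Fin (j + 1) → ℝ :=
  fun i => v (Fin.castLE (Nat.succ_le_succ (Nat.le_of_lt j.isLt)) i)

/-- A prefix of a history in the box `]0,γ]^{k+1}` lies in the box `]0,γ]^{j+1}`. [folklore] -/
theorem pref_mem_box {γ : ℝ} {k : ℕ} {v : Fin (k + 1) → ℝ} (hv : v ∈ Box γ k) (j : Fin k) :
    pref v j ∈ Box γ j :=
  mem_box.2 fun _ => mem_box.1 hv _

/-- Taking a prefix is continuous. [folklore] -/
theorem continuous_pref (k : ℕ) (j : Fin k) : Continuous fun v : Fin (k + 1) → ℝ => pref v j :=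
  continuous_pi fun _ => continuous_apply _

/-- **The (2.13) integrand, exponential form.**  At step `k` (producing `E^{(k+1)}`), for the parameter
`p = ((g_0,…,g_k), U)` (`U = U_{k+1}`, a point of the complex configuration space `Wc k`) and the integration variable
`ω` (the fluctuation field `B` of (2.12) after the scaling `B = g_k B′`, p. 267, and `B′ = CB`, p. 268):
`χ_k(g_k; ω) · exp[ P^{(k)}(g_k, U, ω) + Σ_{j<k} ( E^{(j+1)}(g_0..g_j; σ_{kj}(g_k, U, ω)) − E^{(j+1)}(g_0..g_j; τ_{kj}(U)) ) ]`
— p. 268: *"The expression under the exponential is clearly a sum of two terms, one is connected with the expansion of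
the action … and the measure in (2.1), and we denote it by P^{(k)}(g_k, U_{k+1}, B), another is the expression in the
curly bracket {...}"*, the curly bracket of (2.12) being *"{E_k(U_k(exp i[g_kCB − hD̃(g_kCB)]V^{(k)})) − E_k(U_k(V^{(k)}))}"*
with `E_k = Σ_{j≤k} E^{(j)}` ((1.3)): `σ k j g U ω` = the shifted old configuration `U_j`-image of
`exp i[g CB − hD̃(g CB)]V^{(k)}`, `τ k j U` = the unshifted one.  The HISTORY `(g_0,…,g_{k-1})` enters ONLY through the
old terms (`pref`); `g_k` enters through `χ_k` (the cutoff `|B′(b)| < ε₁` of (2.9) read in the scaled variable: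
`|(g_k Cω − hD̃(g_k Cω))(b)| < ε₁`, the combination of (2.12) — it MOVES with `g_k`), through `P^{(k)}` and through `σ`.
[cite: Balaban1987RG1, (2.12)-(2.13) p.268] -/
def integrand213 (χ : (k : ℕ) → ℝ → Ω k → ℝ) (P : (k : ℕ) → ℝ → Wc k → Ω k → ℂ)
    (T : (k : ℕ) → (Fin (k + 1) → ℝ) → Wc k → ℂ)
    (σ : (k : ℕ) → (j : Fin k) → ℝ → Wc k → Ω k → Wc j) (τ : (k : ℕ) → (j : Fin k) → Wc k → Wc j)
    (k : ℕ) (p : (Fin (k + 1) → ℝ) × Wc k) (ω : Ω k) : ℂ :=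
  (χ k (p.1 (Fin.last k)) ω : ℂ) *
    Complex.exp (P k (p.1 (Fin.last k)) p.2 ω +
      ∑ j : Fin k, (T j (pref p.1 j) (σ k j (p.1 (Fin.last k)) p.2 ω) - T j (pref p.1 j) (τ k j p.2)))

/-- **THE (2.13) TOWER** for the terms `T k (g_0,…,g_k) U = E^{(k+1)}(g_0,…,g_k; U)`, `U ∈ D k ⊆ Wc k` (complex
configurations of (1.5)/(1.17) type), over ONE sequence of lattices.  Data: the cutoffs `χ k` ((2.9)), the explicit
exponents `P k` ((2.12)), the substitution maps `σ k j`, `τ k j` of the curly bracket, the fluctuation measures `μ k`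
((2.12): `dμ_{C^{(k)}}(B)`, here any measure — the `U`-dependence of the covariance `C^{(k)}(U_{k+1})` (p. 268) is
absorbed into `P k` as a density w.r.t. a fixed reference measure [analysis, bookkeeping]), dominating functions.
Clauses, each tagged: `eq213` = (2.13) EXPONENTIATED, `exp E^{(k+1)}(g_k, U_{k+1}) = ∫ dμ χ_k exp[P^{(k)} + {…}]`
[printed (2.13) p. 268, read at complex `U` in the analyticity domain — analytic continuation of both sides:
analysis]; `meas`/`dom`/`integrable` = measurability and an integrable dominating function on the box × domain
[analysis: (2.7)-type bounds `|P^{(k)}| ≤ O(1)p₀(ε₁)`, (1.18) for the old terms, Gaussian reference measure];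
`cutoff` = for each `g ∈ ]0,γ]`, for `μ k`-a.e. `ω`, `g′ ↦ χ k g′ ω` is continuous at `g` within `]0,γ]` [analysis:
the moving sharp cutoff `Π_b χ(|(g′Cω − hD̃(g′Cω))(b)| < ε₁)` ((2.9) in the variables of (2.12)) is locally constant in
`g′` off the level sets `|(gCω − hD̃(gCω))(b)| = ε₁`, which are `μ k`-null for each `g` (level sets of a non-constant
real-analytic function of `ω`; Gaussian measure) — the null set DEPENDS on `g`, whence the pointwise form]; `contP`, `contσ`, `contτ` = continuity of the explicit data in `(g_k, U)` [analysis: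
(2.4)–(2.11) are explicit smooth expressions in `g_k` and analytic in `U`]; `mapsσ`, `mapsτ` = the substituted
configurations stay in the old domains [printed-type: p. 267 *"restrictions on B′(b₀(c)), with the constant ε₁
replaced by O(ε₁)"*, and the domains (1.5)/(1.17)]. NOTHING here asserts continuity of
any `E^{(j)}` — that is the OUTPUT (`Tower213.continuousOn_exp`). [cite: Balaban1987RG1, (2.9) p.266 and (2.12)-(2.14) p.268] -/
structure Tower213 (γ : ℝ) (D : (k : ℕ) → Set (Wc k)) (μ : (k : ℕ) → Measure (Ω k))
    (T : (k : ℕ) → (Fin (k + 1) → ℝ) → Wc k → ℂ) where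
  /-- the (2.9) cutoff in the scaled variable, as a function of `g_k` and `ω` -/
  χ : (k : ℕ) → ℝ → Ω k → ℝ
  /-- the explicit exponent `P^{(k)}(g_k, U_{k+1}, ·)` of (2.12)/(2.13) (incl. the density bookkeeping) -/
  P : (k : ℕ) → ℝ → Wc k → Ω k → ℂ
  /-- the shifted old configurations of the curly bracket of (2.12) -/
  σ : (k : ℕ) → (j : Fin k) → ℝ → Wc k → Ω k → Wc j
  /-- the unshifted old configurations of the curly bracket of (2.12) -/
  τ : (k : ℕ) → (j : Fin k) → Wc k → Wc j
  /-- dominating functions -/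
  bound : (k : ℕ) → Ω k → ℝ
  eq213 : ∀ k, ∀ p ∈ Box γ k ×ˢ D k, Complex.exp (T k p.1 p.2) = ∫ ω, integrand213 χ P T σ τ k p ω ∂μ k
  meas : ∀ k, ∀ p ∈ Box γ k ×ˢ D k, AEStronglyMeasurable (integrand213 χ P T σ τ k p) (μ k)
  dom : ∀ k, ∀ p ∈ Box γ k ×ˢ D k, ∀ᵐ ω ∂μ k, ‖integrand213 χ P T σ τ k p ω‖ ≤ bound k ω
  integrable : ∀ k, Integrable (bound k) (μ k)
  cutoff : ∀ k, ∀ g ∈ Set.Ioc (0 : ℝ) γ, ∀ᵐ ω ∂μ k, ContinuousWithinAt (fun g' => χ k g' ω) (Set.Ioc 0 γ) g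
  contP : ∀ k, ∀ᵐ ω ∂μ k, ContinuousOn (fun q : ℝ × Wc k => P k q.1 q.2 ω) (Set.Ioc 0 γ ×ˢ D k)
  contσ : ∀ k (j : Fin k), ∀ᵐ ω ∂μ k, ContinuousOn (fun q : ℝ × Wc k => σ k j q.1 q.2 ω) (Set.Ioc 0 γ ×ˢ D k)
  mapsσ : ∀ k (j : Fin k), ∀ g ∈ Set.Ioc (0 : ℝ) γ, ∀ U ∈ D k, ∀ ω, σ k j g U ω ∈ D j
  contτ : ∀ k (j : Fin k), ContinuousOn (τ k j) (D k)
  mapsτ : ∀ k (j : Fin k), Set.MapsTo (τ k j) (D k) (D j)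

namespace Tower213

variable {γ : ℝ} {D : (k : ℕ) → Set (Wc k)} {μ : (k : ℕ) → Measure (Ω k)}
  {T : (k : ℕ) → (Fin (k + 1) → ℝ) → Wc k → ℂ}

/-- **One step of the induction**: if the exponentiated old terms `exp E^{(j+1)}`, `j < k`, are jointly continuous
in (history, configuration) on `]0,γ]^{j+1} × D j`, then so is `exp E^{(k+1)}` on `]0,γ]^{k+1} × D k` — dominated
convergence for the (2.13) integral at each point (Mathlib `MeasureTheory.continuousWithinAt_of_dominated`; the
exceptional null set may depend on the point, as the moving cutoff requires), the integrand being a.e. continuous at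
the point by `cutoff`, `contP`, `contσ`/`contτ` and the hypothesis on the old terms (`exp` of the curly bracket =
`Π_j exp E^{(j+1)}(σ) / exp E^{(j+1)}(τ)`). [folklore] -/
theorem step (𝒯 : Tower213 γ D μ T) (k : ℕ)
    (ih : ∀ j : Fin k, ContinuousOn (fun p : (Fin (j + 1) → ℝ) × Wc j => Complex.exp (T j p.1 p.2))
      (Box γ j ×ˢ D j)) :
    ContinuousOn (fun p : (Fin (k + 1) → ℝ) × Wc k => Complex.exp (T k p.1 p.2)) (Box γ k ×ˢ D k) := by
  have hint : ContinuousOn (fun p : (Fin (k + 1) → ℝ) × Wc k =>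
      ∫ ω, integrand213 𝒯.χ 𝒯.P T 𝒯.σ 𝒯.τ k p ω ∂μ k) (Box γ k ×ˢ D k) := by
    intro p₀ hp₀
    have hg₀ : p₀.1 (Fin.last k) ∈ Set.Ioc (0 : ℝ) γ := (mem_box.1 hp₀.1) (Fin.last k)
    refine continuousWithinAt_of_dominated (bound := 𝒯.bound k) ?_ ?_ (𝒯.integrable k) ?_
    · exact eventually_nhdsWithin_of_forall (𝒯.meas k)
    · exact eventually_nhdsWithin_of_forall (𝒯.dom k)
    filter_upwards [𝒯.cutoff k _ hg₀, 𝒯.contP k, eventually_all.2 fun j => 𝒯.contσ k j] with ω hχ hP hσ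
    set s : Set ((Fin (k + 1) → ℝ) × Wc k) := Box γ k ×ˢ D k with hs
    have hlast : ContinuousWithinAt (fun p : (Fin (k + 1) → ℝ) × Wc k => p.1 (Fin.last k)) s p₀ :=
      ((continuous_apply (Fin.last k)).comp continuous_fst).continuousWithinAt
    have hmaps1 : Set.MapsTo (fun p : (Fin (k + 1) → ℝ) × Wc k => p.1 (Fin.last k)) s (Set.Ioc 0 γ) :=
      fun p hp => (mem_box.1 hp.1) (Fin.last k)
    have hgU : ContinuousWithinAt (fun p : (Fin (k + 1) → ℝ) × Wc k => (p.1 (Fin.last k), p.2)) s p₀ :=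
      hlast.prodMk continuous_snd.continuousWithinAt
    have hmaps2 : Set.MapsTo (fun p : (Fin (k + 1) → ℝ) × Wc k => (p.1 (Fin.last k), p.2)) s
        (Set.Ioc 0 γ ×ˢ D k) := fun p hp => ⟨(mem_box.1 hp.1) (Fin.last k), hp.2⟩
    have f1' : ContinuousWithinAt (fun p : (Fin (k + 1) → ℝ) × Wc k => 𝒯.χ k (p.1 (Fin.last k)) ω) s p₀ :=
      hχ.comp (f := fun p : (Fin (k + 1) → ℝ) × Wc k => p.1 (Fin.last k)) hlast hmaps1
    have f1 : ContinuousWithinAt (fun p : (Fin (k + 1) → ℝ) × Wc k => (𝒯.χ k (p.1 (Fin.last k)) ω : ℂ)) s p₀ :=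
      Complex.continuous_ofReal.continuousAt.comp_continuousWithinAt f1'
    have f2 : ContinuousWithinAt (fun p : (Fin (k + 1) → ℝ) × Wc k => 𝒯.P k (p.1 (Fin.last k)) p.2 ω) s p₀ :=
      (hP (p₀.1 (Fin.last k), p₀.2) (hmaps2 hp₀)).comp
        (f := fun p : (Fin (k + 1) → ℝ) × Wc k => (p.1 (Fin.last k), p.2)) hgU hmaps2
    have f3 : ∀ j : Fin k, ContinuousWithinAt (fun p : (Fin (k + 1) → ℝ) × Wc k =>
        Complex.exp (T j (pref p.1 j) (𝒯.σ k j (p.1 (Fin.last k)) p.2 ω)) /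
          Complex.exp (T j (pref p.1 j) (𝒯.τ k j p.2))) s p₀ := by
      intro j
      have hprefc : ContinuousWithinAt (fun p : (Fin (k + 1) → ℝ) × Wc k => pref p.1 j) s p₀ :=
        ((continuous_pref k j).comp continuous_fst).continuousWithinAt
      have hσc : ContinuousWithinAt (fun p : (Fin (k + 1) → ℝ) × Wc k => 𝒯.σ k j (p.1 (Fin.last k)) p.2 ω) s p₀ :=
        ((hσ j) (p₀.1 (Fin.last k), p₀.2) (hmaps2 hp₀)).comp
          (f := fun p : (Fin (k + 1) → ℝ) × Wc k => (p.1 (Fin.last k), p.2)) hgU hmaps2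
      have hτc : ContinuousWithinAt (fun p : (Fin (k + 1) → ℝ) × Wc k => 𝒯.τ k j p.2) s p₀ :=
        ((𝒯.contτ k j) p₀.2 hp₀.2).comp (f := fun p : (Fin (k + 1) → ℝ) × Wc k => p.2)
          continuous_snd.continuousWithinAt fun p hp => hp.2
      have hnum : ContinuousWithinAt (fun p : (Fin (k + 1) → ℝ) × Wc k =>
          Complex.exp (T j (pref p.1 j) (𝒯.σ k j (p.1 (Fin.last k)) p.2 ω))) s p₀ :=
        ((ih j) (pref p₀.1 j, 𝒯.σ k j (p₀.1 (Fin.last k)) p₀.2 ω)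
          ⟨pref_mem_box hp₀.1 j, 𝒯.mapsσ k j _ hg₀ _ hp₀.2 ω⟩).comp
          (f := fun p : (Fin (k + 1) → ℝ) × Wc k => (pref p.1 j, 𝒯.σ k j (p.1 (Fin.last k)) p.2 ω))
          (hprefc.prodMk hσc)
          fun p hp => ⟨pref_mem_box hp.1 j, 𝒯.mapsσ k j _ (hmaps1 hp) _ hp.2 ω⟩
      have hden : ContinuousWithinAt (fun p : (Fin (k + 1) → ℝ) × Wc k =>
          Complex.exp (T j (pref p.1 j) (𝒯.τ k j p.2))) s p₀ :=
        ((ih j) (pref p₀.1 j, 𝒯.τ k j p₀.2) ⟨pref_mem_box hp₀.1 j, 𝒯.mapsτ k j hp₀.2⟩).comp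
          (f := fun p : (Fin (k + 1) → ℝ) × Wc k => (pref p.1 j, 𝒯.τ k j p.2))
          (hprefc.prodMk hτc) fun p hp => ⟨pref_mem_box hp.1 j, 𝒯.mapsτ k j hp.2⟩
      exact hnum.div hden (Complex.exp_ne_zero _)
    have f3' : ContinuousWithinAt (fun p : (Fin (k + 1) → ℝ) × Wc k => ∏ j : Fin k,
        Complex.exp (T j (pref p.1 j) (𝒯.σ k j (p.1 (Fin.last k)) p.2 ω)) /
          Complex.exp (T j (pref p.1 j) (𝒯.τ k j p.2))) s p₀ :=
      tendsto_finsetProd _ fun j _ => f3 j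
    have key : ∀ p : (Fin (k + 1) → ℝ) × Wc k, integrand213 𝒯.χ 𝒯.P T 𝒯.σ 𝒯.τ k p ω =
        (𝒯.χ k (p.1 (Fin.last k)) ω : ℂ) * (Complex.exp (𝒯.P k (p.1 (Fin.last k)) p.2 ω) *
          ∏ j : Fin k, Complex.exp (T j (pref p.1 j) (𝒯.σ k j (p.1 (Fin.last k)) p.2 ω)) /
            Complex.exp (T j (pref p.1 j) (𝒯.τ k j p.2))) := by
      intro p
      simp only [integrand213, Complex.exp_add, Complex.exp_sum, Complex.exp_sub]
    simp only [key]
    exact f1.mul (f2.cexp.mul f3')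
  exact hint.congr fun p hp => 𝒯.eq213 k p hp

/-- **THE TOWER THEOREM**: along the (2.13) recursion, `exp E^{(k+1)}(g_0,…,g_k; U)` is jointly continuous in
(history, configuration) on `]0,γ]^{k+1} × D k`, for EVERY `k` — strong induction on `k` over `step` (the base case
`k = 0` is `step` with an empty curly bracket: the first renormalization step, `E_0 = 0`).  In particular, for each
fixed configuration `U ∈ D k`, the history-dependence `(g_0,…,g_k) ↦ exp E^{(k+1)}(g_0,…,g_k; U)` is continuous on the
box: the input `hval` of §3. [folklore] -/
theorem continuousOn_exp (𝒯 : Tower213 γ D μ T) (k : ℕ) :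
    ContinuousOn (fun p : (Fin (k + 1) → ℝ) × Wc k => Complex.exp (T k p.1 p.2)) (Box γ k ×ˢ D k) := by
  induction k using Nat.strong_induction_on with
  | _ k ih => exact 𝒯.step k fun j => ih j j.isLt

/-- Pointwise-in-`U` form: for a fixed configuration `U ∈ D k`, the history-dependence
`(g_0,…,g_k) ↦ exp E^{(k+1)}(g_0,…,g_k; U)` is continuous on the box. [folklore] -/
theorem continuousOn_exp_at (𝒯 : Tower213 γ D μ T) (k : ℕ) {U : Wc k} (hU : U ∈ D k) :
    ContinuousOn (fun v : Fin (k + 1) → ℝ => Complex.exp (T k v U)) (Box γ k) :=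
  (𝒯.continuousOn_exp k).comp (continuousOn_id.prodMk continuousOn_const) fun _ hv => ⟨hv, hU⟩

end Tower213

end Tower

/-! ## 5. Assembly: towers per torus ⇒ (C-fin) ⇒ (C) ⇒ the END-STATEMENT consumers -/

section Assembly

open Literature.MathematicalPhysics.QuantumFieldTheory.Balaban1983to89.FlowStep
open Literature.MathematicalPhysics.QuantumFieldTheory.Balaban1983to89.FlowStepRuns
open Literature.MathematicalPhysics.QuantumFieldTheory.Balaban1983to89.DagBinding
open Literature.MathematicalPhysics.QuantumFieldTheory.Balaban1983to89.Beta.RemainderChain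
open Literature.MathematicalPhysics.QuantumFieldTheory.Balaban1983to89.Beta.BetaContinuity
open Literature.MathematicalPhysics.QuantumFieldTheory.Balaban1983to89.Beta.BetaContinuityVolume

variable {d : ℕ} {side : ℕ → ℕ → ℕ} [∀ k t, NeZero (side k t)]
variable {V : ℕ → ℕ → Type*} [∀ k t, NormedAddCommGroup (V k t)] [∀ k t, NormedSpace ℂ (V k t)]
variable {Wc : ℕ → ℕ → Type*} [∀ t k, TopologicalSpace (Wc t k)] [∀ t k, FirstCountableTopology (Wc t k)]
variable {Ω : ℕ → ℕ → Type*} [∀ t k, MeasurableSpace (Ω t k)]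

omit [∀ k t, NormedSpace ℂ (V k t)] in
/-- **`hval` from a family of (2.13) towers, one per torus `t`**, and the field maps `ι k t : V k t → Wc t k`,
`B ↦ U_{k+1}(exp iB)` (continuous, mapping the closed ball `‖B‖ ≤ ρ k t` into the domain `D t k` — p. 263/(1.17):
small complex fields give configurations in the analyticity domain). [cite: Balaban1987RG1, (1.17) p.263 and (1.20) p.264] -/
theorem hval_of_towers {γ : ℝ} {D : (t k : ℕ) → Set (Wc t k)} {μm : (t k : ℕ) → Measure (Ω t k)}
    {Tt : (t k : ℕ) → (Fin (k + 1) → ℝ) → Wc t k → ℂ} (𝒯 : ∀ t, Tower213 γ (D t) (μm t) (Tt t))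
    (ι : (k t : ℕ) → V k t → Wc t k) (ρ : ℕ → ℕ → ℝ)
    (hιD : ∀ k t, Set.MapsTo (ι k t) (closedBall 0 (ρ k t)) (D t k)) :
    ∀ k t, ∀ w ∈ closedBall (0 : V k t) (ρ k t),
      ContinuousOn (fun v => Complex.exp (Tt t k v (ι k t w))) (Box γ k) :=
  fun k t _ hw => (𝒯 t).continuousOn_exp_at k (hιD k t hw)

/-- **(C) `BetaContH γ β` from a REMAINDER CHAIN + (VR-u) + the (2.13) towers.**  The clause (C-fin) of
`BetaContinuityVolume.betaContH_of_chain_volumeRate` is DISCHARGED [kernel] from: per torus `t` a (2.13) tower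
(`Tower213`: (2.13) exponentiated, dominating functions, the moving-cutoff null-boundary clause, continuity of the
explicit data), the field maps `ι`, printed-type analyticity and bounds of the finite-volume generating functions
`B ↦ E^{(k+1),T_t}(v; U_{k+1}(exp iB))` (`han`, `hbd`), and the (1.20)–(1.21) dictionary `hrepr` for the torus
remainder kernels.  What stays hypothesis, by name: the leaves inside `R` (row an4's located loci), (VR-u) `hrate`/`hρ`
(row pv10, `LocalizedVolumeRate`), and the tower clauses — each of printed type or routine analysis, none a continuity
statement about `β`, `Π` or `E^{(j)}`. [cite: Balaban1987RG1, (1.20)-(1.22) p.264 and (2.13) p.268] -/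
theorem betaContH_of_chain_towers (hside : ∀ k, Tendsto (side k) atTop atTop) {μ ν : Fin d} {β : HBeta}
    {S : B12Beta.OneLoopSplit β} {γ : ℝ} {c : B13.Consts} {α₂ B₃ c₁ K₀ K₁ : ℝ}
    (R : Chain d μ ν S γ c α₂ B₃ c₁ K₀ K₁) (hs : ChainSigns c α₂ B₃ K₀)
    (PT : (k t : ℕ) → (Fin (k + 1) → ℝ) → Fin d → Fin d → Site d (side k t) → ℝ) (ρv : ℕ → ℕ → ℝ) (δ : ℕ → ℝ)
    (hrate : ∀ k, ∀ v ∈ Box γ k, VolumeRate (side k) (fun t => PT k t v) (R.P1 k v) (ρv k) (δ k))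
    (hρv : ∀ k, Tendsto (ρv k) atTop (𝓝 0))
    {D : (t k : ℕ) → Set (Wc t k)} {μm : (t k : ℕ) → Measure (Ω t k)}
    {Tt : (t k : ℕ) → (Fin (k + 1) → ℝ) → Wc t k → ℂ} (𝒯 : ∀ t, Tower213 γ (D t) (μm t) (Tt t))
    (ι : (k t : ℕ) → V k t → Wc t k) (e : (k t : ℕ) → Fin d → Site d (side k t) → V k t)
    (Q : (k t : ℕ) → Site d (side k t) → ℝ) (α ρ Sb : ℕ → ℕ → ℝ)
    (hρ : ∀ k t, 0 < ρ k t) (hρα : ∀ k t, ρ k t < α k t)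
    (hιD : ∀ k t, Set.MapsTo (ι k t) (closedBall 0 (ρ k t)) (D t k))
    (han : ∀ k t, ∀ v ∈ Box γ k, AnalyticOnNhd ℂ (fun B => Tt t k v (ι k t B)) (ball 0 (α k t)))
    (hbd : ∀ k t, ∀ v ∈ Box γ k, ∀ B ∈ closedBall (0 : V k t) (ρ k t), ‖Tt t k v (ι k t B)‖ ≤ Sb k t)
    (hrepr : ∀ k t, ∀ v ∈ Box γ k, ∀ x,
      PT k t v μ ν x = (mixedDeriv (fun B => Tt t k v (ι k t B)) (e k t μ x) (e k t ν 0)).re + Q k t x) :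
    BetaContH γ β :=
  betaContH_of_chain_volumeRate hside R hs PT ρv δ hrate hρv
    (cfin_of_expValues μ ν PT (fun k t v B => Tt t k v (ι k t B)) e Q α ρ Sb hρ hρα han hbd
      (hval_of_towers 𝒯 ι ρ hιD) hrepr)

/-- **END TO END, literal grade, (C) ⇐ towers + (VR-u)**: `B12.Thm2Printed C L` from (AF-0) on all scales, a
remainder chain with the printed signs, the ε₁-restriction, (VR-u), the (2.13) towers with the (1.20) dictionary,
and the printed upper bound (`BetaContinuityVolume.thm2Printed_of_remainderChain_vol`).  NOT Theorem 2
unconditionally: (AF-0), the leaves inside `R`, (VR-u) and the tower clauses are hypotheses no printed source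
supplies as theorems. [cite: Balaban1987RG1, Thm 2 (0.31) p.259] -/
theorem thm2Printed_of_remainderChain_towers (hside : ∀ k, Tendsto (side k) atTop atTop)
    {C : B12.Construction} {β : HBeta} (hgen : ForwardGenerated C β) {μ ν : Fin d}
    (S : B12Beta.OneLoopSplit β) {γ₀ : ℝ} {c : B13.Consts} {α₂ B₃ c₁ K₀ K₁ : ℝ}
    (R : Chain d μ ν S γ₀ c α₂ B₃ c₁ K₀ K₁) (hs : ChainSigns c α₂ B₃ K₀) {L b β' : ℝ}
    (hL : 1 < L) (hγ₀ : 0 < γ₀) (hb : 0 < b) (hAF0 : ∀ k, 2 * b ≤ S.β0 k)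
    (hε₁ : c.ε₁ * remCoeff d c α₂ B₃ c₁ K₀ K₁ ≤ b)
    (PT : (k t : ℕ) → (Fin (k + 1) → ℝ) → Fin d → Fin d → Site d (side k t) → ℝ) (ρv : ℕ → ℕ → ℝ) (δ : ℕ → ℝ)
    (hrate : ∀ k, ∀ v ∈ Box γ₀ k, VolumeRate (side k) (fun t => PT k t v) (R.P1 k v) (ρv k) (δ k))
    (hρv : ∀ k, Tendsto (ρv k) atTop (𝓝 0))
    {D : (t k : ℕ) → Set (Wc t k)} {μm : (t k : ℕ) → Measure (Ω t k)}
    {Tt : (t k : ℕ) → (Fin (k + 1) → ℝ) → Wc t k → ℂ} (𝒯 : ∀ t, Tower213 γ₀ (D t) (μm t) (Tt t))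
    (ι : (k t : ℕ) → V k t → Wc t k) (e : (k t : ℕ) → Fin d → Site d (side k t) → V k t)
    (Q : (k t : ℕ) → Site d (side k t) → ℝ) (α ρ Sb : ℕ → ℕ → ℝ)
    (hρ : ∀ k t, 0 < ρ k t) (hρα : ∀ k t, ρ k t < α k t)
    (hιD : ∀ k t, Set.MapsTo (ι k t) (closedBall 0 (ρ k t)) (D t k))
    (han : ∀ k t, ∀ v ∈ Box γ₀ k, AnalyticOnNhd ℂ (fun B => Tt t k v (ι k t B)) (ball 0 (α k t)))
    (hbd : ∀ k t, ∀ v ∈ Box γ₀ k, ∀ B ∈ closedBall (0 : V k t) (ρ k t), ‖Tt t k v (ι k t B)‖ ≤ Sb k t)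
    (hrepr : ∀ k t, ∀ v ∈ Box γ₀ k, ∀ x,
      PT k t v μ ν x = (mixedDeriv (fun B => Tt t k v (ι k t B)) (e k t μ x) (e k t ν 0)).re + Q k t x)
    (hup : BetaUpperH β' γ₀ β) : B12.Thm2Printed C L :=
  thm2Printed_of_remainderChain_vol hside hgen S R hs hL hγ₀ hb hAF0 hε₁ PT ρv δ hrate hρv
    (cfin_of_expValues μ ν PT (fun k t v B => Tt t k v (ι k t B)) e Q α ρ Sb hρ hρα han hbd
      (hval_of_towers 𝒯 ι ρ hιD) hrepr) hup

/-- **END-STATEMENT grade, (C) ⇐ towers + (VR-u)**: endpoint existence from a one-loop tail bound, a remainder chain,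
the ε₁-restriction, (VR-u), the (2.13) towers with the (1.20) dictionary, and the printed two-sided bound
(`BetaContinuityVolume.endpointExistence_of_remainderChain_vol`). [cite: Balaban1987RG1, Thm 2 p.259 (first sentence)] -/
theorem endpointExistence_of_remainderChain_towers (hside : ∀ k, Tendsto (side k) atTop atTop)
    {C : B12.Construction} {β : HBeta} (hgen : ForwardGenerated C β) {μ ν : Fin d}
    (S : B12Beta.OneLoopSplit β) {γ₀ : ℝ} {c : B13.Consts} {α₂ B₃ c₁ K₀ K₁ : ℝ}
    (R : Chain d μ ν S γ₀ c α₂ B₃ c₁ K₀ K₁) (hs : ChainSigns c α₂ B₃ K₀) {b β' : ℝ} {k₀ : ℕ}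
    (hγ₀ : 0 < γ₀) (hb : 0 < b) (hβ' : 0 ≤ β') (hAF0 : ∀ k, k₀ ≤ k → 2 * b ≤ S.β0 k)
    (hε₁ : c.ε₁ * remCoeff d c α₂ B₃ c₁ K₀ K₁ ≤ b)
    (PT : (k t : ℕ) → (Fin (k + 1) → ℝ) → Fin d → Fin d → Site d (side k t) → ℝ) (ρv : ℕ → ℕ → ℝ) (δ : ℕ → ℝ)
    (hrate : ∀ k, ∀ v ∈ Box γ₀ k, VolumeRate (side k) (fun t => PT k t v) (R.P1 k v) (ρv k) (δ k))
    (hρv : ∀ k, Tendsto (ρv k) atTop (𝓝 0))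
    {D : (t k : ℕ) → Set (Wc t k)} {μm : (t k : ℕ) → Measure (Ω t k)}
    {Tt : (t k : ℕ) → (Fin (k + 1) → ℝ) → Wc t k → ℂ} (𝒯 : ∀ t, Tower213 γ₀ (D t) (μm t) (Tt t))
    (ι : (k t : ℕ) → V k t → Wc t k) (e : (k t : ℕ) → Fin d → Site d (side k t) → V k t)
    (Q : (k t : ℕ) → Site d (side k t) → ℝ) (α ρ Sb : ℕ → ℕ → ℝ)
    (hρ : ∀ k t, 0 < ρ k t) (hρα : ∀ k t, ρ k t < α k t)
    (hιD : ∀ k t, Set.MapsTo (ι k t) (closedBall 0 (ρ k t)) (D t k))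
    (han : ∀ k t, ∀ v ∈ Box γ₀ k, AnalyticOnNhd ℂ (fun B => Tt t k v (ι k t B)) (ball 0 (α k t)))
    (hbd : ∀ k t, ∀ v ∈ Box γ₀ k, ∀ B ∈ closedBall (0 : V k t) (ρ k t), ‖Tt t k v (ι k t B)‖ ≤ Sb k t)
    (hrepr : ∀ k t, ∀ v ∈ Box γ₀ k, ∀ x,
      PT k t v μ ν x = (mixedDeriv (fun B => Tt t k v (ι k t B)) (e k t μ x) (e k t ν 0)).re + Q k t x)
    (hlo : ∀ k, ∀ v ∈ Box γ₀ k, -β' ≤ β k v) (hup : BetaUpperH β' γ₀ β) : EndpointExistence C :=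
  endpointExistence_of_remainderChain_vol hside hgen S R hs hγ₀ hb hβ' hAF0 hε₁ PT ρv δ hrate hρv
    (cfin_of_expValues μ ν PT (fun k t v B => Tt t k v (ι k t B)) e Q α ρ Sb hρ hρα han hbd
      (hval_of_towers 𝒯 ι ρ hιD) hrepr) hlo hup

end Assembly

/-! ## 6. Non-vacuity: the clause set of `Tower213` is simultaneously satisfiable -/

section NonVacuity

/-- A trivial tower (one-point configuration and probability spaces, all terms zero, cutoff ≡ 1): every clause of
`Tower213` holds, so the structure is not vacuous and `Tower213.continuousOn_exp` has an instance. [folklore] -/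
def trivialTower (γ : ℝ) : Tower213 (Wc := fun _ => Unit) (Ω := fun _ => Unit) γ (fun _ => Set.univ)
    (fun _ => Measure.dirac ()) (fun _ _ _ => 0) where
  χ := fun _ _ _ => 1
  P := fun _ _ _ _ => 0
  σ := fun _ _ _ _ _ => ()
  τ := fun _ _ _ => ()
  bound := fun _ _ => 1
  eq213 := by
    intro k p _
    rw [MeasureTheory.integral_dirac]
    simp [integrand213]
  meas := fun _ _ _ => (measurable_of_finite _).aestronglyMeasurable
  dom := fun _ _ _ => Eventually.of_forall fun _ => by simp [integrand213]
  integrable := fun _ => integrable_const _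
  cutoff := fun _ _ _ => Eventually.of_forall fun _ => continuousWithinAt_const
  contP := fun _ => Eventually.of_forall fun _ => continuousOn_const
  contσ := fun _ _ => Eventually.of_forall fun _ => continuousOn_const
  mapsσ := fun _ _ _ _ _ _ _ => Set.mem_univ _
  contτ := fun _ _ => continuousOn_const
  mapsτ := fun _ _ => Set.mapsTo_univ _ _

example (γ : ℝ) (k : ℕ) :
    ContinuousOn (fun p : (Fin (k + 1) → ℝ) × Unit => Complex.exp ((fun _ _ => (0 : ℂ)) p.1 p.2))
      (FlowStep.Box γ k ×ˢ Set.univ) :=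
  (trivialTower γ).continuousOn_exp k

end NonVacuity

end

end Literature.MathematicalPhysics.QuantumFieldTheory.Balaban1983to89.Beta.HistoryContinuity
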